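import Mathlib
import Summits.Ventures.PercRepro2.Defs
import Summits.Ventures.PercRepro2.Independence
import Summits.Ventures.PercRepro2.Harris
import Summits.Ventures.PercRepro2.ZCTwoEdge
import Summits.Ventures.PercRepro2.ZCA3OWCert
import Summits.Ventures.PercRepro2.ZCA3WTypes
import Summits.Ventures.PercRepro2.ZCOA3W
import Summits.Ventures.PercRepro2.ZCA3OWCells

/-!
# Theorem J (MINE-A.md §74.5), abstract form — (ZC) when `a₃` has degree two with neighbours `o`
and a non-mark `w` (the second MIRROR placement of §70.8), from (ZC) on `G − a₃` for the marks
`(a₁, w, o)` and BHK06 avoidance (blind cell PercRepro2, mine-a g25)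

Abstract setting: two distinct edges `f₁` (`a₃ o`, weight `p f₁`), `f₂` (`a₃ w`, weight `p f₂`) and
seven events of the configuration space that ignore `f₁`, `f₂` — in the graph instance
(`ZCA3OWGraph.lean`) the events of `G − a₃`: `A = {a₁ ↔ o}`, `W = {a₁ ↔ w}`, `Γ = {o ↔ w}`,
`X₀ = {C(a₁) ∈ 𝒰}`, `X₁ = {C(a₁) ∪ {a₃} ∈ 𝒰}`, `X₂ = {C(a₁) ∪ C(w) ∪ {a₃} ∈ 𝒰}`,
`X₃ = {C(a₁) ∪ C(o) ∪ {a₃} ∈ 𝒰}`, `X₄ = {C(a₁) ∪ C(o) ∪ C(w) ∪ {a₃} ∈ 𝒰}`.  The five types of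
`(a₁, o, w)` are `T₁ = A ∩ W`, `T₂ = A ∩ Wᶜ`, `T₃ = Aᶜ ∩ W`, `T₄ = Aᶜ ∩ Wᶜ ∩ Γ`, `T₅ = Aᶜ ∩ Wᶜ ∩ Γᶜ`
(`ZCA3WTypes`), and the (ZC) events are `e = ({f₁} ∩ A) ∪ ({f₂} ∩ W)`, `L = A ∪ ({f₁, f₂} ∩ W)`,
`γ = {f₁} ∪ ({f₂} ∩ Γ)`, `U` as in `ZCA3OWCells` (Theorem I with `e` and `L` exchanged; the type
bookkeeping `prob_mix3`, `prob_mix4`, `prob_mixA`, `prob_inter_AcWc` of `ZCOA3W` is reused).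

**Theorem** (`zc_a3ow`): with the seven events increasing, the transitivity relations, the inclusions
`X₀ ⊆ X₁ ⊆ X₂ ⊆ X₄`, `X₁ ⊆ X₃`, the coincidences `X₃ ∩ A = X₁ ∩ A`, `X₄ ∩ A = X₂ ∩ A`,
`X₂ ∩ W = X₁ ∩ W`, `X₄ ∩ W = X₃ ∩ W`, `X₂ ∩ Γ = X₃ ∩ Γ`, `X₄ ∩ Γ = X₂ ∩ Γ`, lemma (P1) in the two
forms with `w` and with `a₁` in the middle, the inductive hypothesis `(ZC)(W, A, Γ; X₁) ≥ 0` (= (ZC) on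
`G − a₃` for the marks `(a₁, w, o)` and the up-set shifted by `a₃`) and the BHK06-avoidance inequality
`P(X₁ ∩ T₄) · P(Aᶜ ∩ Wᶜ) ≤ P(X₁ ∩ (Aᶜ ∩ Wᶜ)) · P(T₄)` (`bhk_inside_outside_avoid`: given that the root
cluster avoids `{o, w}`, its up-set event and the outside connection `o ↔ w` are negatively
correlated), (ZC) `P(D) Cov(U, eL) − P(B) Cov(U, e¬L) ≥ 0`.  Proof: the cell expansions, the type
bookkeeping and the kernel certificate `zc_a3ow_cert` (246 terms, kit j278608).  One seat.
-/

namespace Summit.Ventures.PercRepro2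


section TheoremJAbstract

variable {E : Type*} [Fintype E] [DecidableEq E] {R : Type*} [CommRing R] [LinearOrder R]
  [IsStrictOrderedRing R]

/-- **Theorem J, abstract form** — see the module docstring. -/
theorem zc_a3ow {p : E → R} (hp : IsProbVec p) {f₁ f₂ : E} (hf : f₁ ≠ f₂)
    {A W Γ X₀ X₁ X₂ X₃ X₄ : Set (Config E)}
    (hA : ∀ (ω : Config E) (b₁ b₂ : Bool),
      Function.update (Function.update ω f₁ b₁) f₂ b₂ ∈ A ↔ ω ∈ A)
    (hW : ∀ (ω : Config E) (b₁ b₂ : Bool),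
      Function.update (Function.update ω f₁ b₁) f₂ b₂ ∈ W ↔ ω ∈ W)
    (hΓ : ∀ (ω : Config E) (b₁ b₂ : Bool),
      Function.update (Function.update ω f₁ b₁) f₂ b₂ ∈ Γ ↔ ω ∈ Γ)
    (hX₀ : ∀ (ω : Config E) (b₁ b₂ : Bool),
      Function.update (Function.update ω f₁ b₁) f₂ b₂ ∈ X₀ ↔ ω ∈ X₀)
    (hX₁ : ∀ (ω : Config E) (b₁ b₂ : Bool),
      Function.update (Function.update ω f₁ b₁) f₂ b₂ ∈ X₁ ↔ ω ∈ X₁)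
    (hX₂ : ∀ (ω : Config E) (b₁ b₂ : Bool),
      Function.update (Function.update ω f₁ b₁) f₂ b₂ ∈ X₂ ↔ ω ∈ X₂)
    (hX₃ : ∀ (ω : Config E) (b₁ b₂ : Bool),
      Function.update (Function.update ω f₁ b₁) f₂ b₂ ∈ X₃ ↔ ω ∈ X₃)
    (hAup : IsUpperSet A) (hWup : IsUpperSet W) (hΓup : IsUpperSet Γ)
    (hX₀up : IsUpperSet X₀) (hX₁up : IsUpperSet X₁) (hX₂up : IsUpperSet X₂)
    (hX₃up : IsUpperSet X₃) (hX₄up : IsUpperSet X₄)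
    (hWΓ : ∀ ω, ω ∈ W → ω ∈ Γ → ω ∈ A)
    (h01 : X₀ ⊆ X₁) (h12 : X₁ ⊆ X₂) (h13 : X₁ ⊆ X₃) (h24 : X₂ ⊆ X₄)
    (h3A : X₃ ∩ A = X₁ ∩ A) (h4A : X₄ ∩ A = X₂ ∩ A) (h2W : X₂ ∩ W = X₁ ∩ W)
    (h4W : X₄ ∩ W = X₃ ∩ W) (h2Γ : X₂ ∩ Γ = X₃ ∩ Γ) (h4Γ : X₄ ∩ Γ = X₂ ∩ Γ)
    (hP1b : prob p (Aᶜ ∩ W) * prob p (Aᶜ ∩ Wᶜ ∩ Γ) ≤ prob p (A ∩ W) * prob p (Aᶜ ∩ Wᶜ ∩ Γᶜ))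
    (hP1c : prob p (A ∩ Wᶜ) * prob p (Aᶜ ∩ W) ≤ prob p (A ∩ W) * prob p (Aᶜ ∩ Wᶜ ∩ Γᶜ))
    (hNA₁' : prob p (X₁ ∩ (Aᶜ ∩ Wᶜ ∩ Γ)) * prob p (Aᶜ ∩ Wᶜ)
      ≤ prob p (X₁ ∩ (Aᶜ ∩ Wᶜ)) * prob p (Aᶜ ∩ Wᶜ ∩ Γ))
    (hZC₁ : 0 ≤ prob p (Aᶜ ∩ Wᶜ ∩ Γᶜ) * (prob p (X₁ ∩ (A ∩ W)) - prob p X₁ * prob p (A ∩ W))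
      - prob p (Aᶜ ∩ Wᶜ ∩ Γ) * (prob p (X₁ ∩ (Aᶜ ∩ W)) - prob p X₁ * prob p (Aᶜ ∩ W))) :
    let e := (openEdge f₁ ∩ A) ∪ (openEdge f₂ ∩ W)
    let L := A ∪ (openEdge f₁ ∩ openEdge f₂ ∩ W)
    let U := (openEdge f₁ ∩ openEdge f₂ ∩ A ∩ Wᶜ ∩ X₂) ∪ (openEdge f₁ ∩ openEdge f₂ ∩ Aᶜ ∩ W ∩ X₃)
      ∪ (e ∩ (openEdge f₁ ∩ openEdge f₂ ∩ ((A ∩ Wᶜ) ∪ (Aᶜ ∩ W)))ᶜ ∩ X₁) ∪ (eᶜ ∩ X₀)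
    let γ := openEdge f₁ ∪ (openEdge f₂ ∩ Γ)
    0 ≤ prob p (eᶜ ∩ Lᶜ ∩ γᶜ) * (prob p (U ∩ (e ∩ L)) - prob p U * prob p (e ∩ L))
      - prob p (eᶜ ∩ Lᶜ ∩ γ) * (prob p (U ∩ (e ∩ Lᶜ)) - prob p U * prob p (e ∩ Lᶜ)) := by
  intro e L U γ
  -- the cell expansions
  have PeL := a3ow_prob_eL p hf hA hW
  have PenL := a3ow_prob_enL p hf hA hW
  have PUeL := a3ow_prob_UeL p hf (X₀ := X₀) hA hW hX₁ hX₂ hX₃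
  have PUenL := a3ow_prob_UenL p hf (X₀ := X₀) (X₂ := X₂) (X₃ := X₃) hA hW hX₁
  have PU := a3ow_prob_U p hf hA hW hX₀ hX₁ hX₂ hX₃
  have PB := a3ow_prob_B p hf hA hW hΓ
  have PD := a3ow_prob_D p hf hA hW hΓ
  -- the coincidences in the masses
  have c31 : prob p (X₃ ∩ (A ∩ W)) = prob p (X₁ ∩ (A ∩ W)) := by
    rw [← Set.inter_assoc, ← Set.inter_assoc, h3A]
  have c32 : prob p (X₃ ∩ (A ∩ Wᶜ)) = prob p (X₁ ∩ (A ∩ Wᶜ)) := by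
    rw [← Set.inter_assoc, ← Set.inter_assoc, h3A]
  have c21 : prob p (X₂ ∩ (A ∩ W)) = prob p (X₁ ∩ (A ∩ W)) := by
    rw [← Set.inter_assoc, ← Set.inter_assoc, Set.inter_comm X₂ A, Set.inter_comm X₁ A,
      Set.inter_assoc, Set.inter_assoc, h2W]
  have c23 : prob p (X₂ ∩ (Aᶜ ∩ W)) = prob p (X₁ ∩ (Aᶜ ∩ W)) := by
    rw [← Set.inter_assoc, ← Set.inter_assoc, Set.inter_comm X₂ Aᶜ, Set.inter_comm X₁ Aᶜ,
      Set.inter_assoc, Set.inter_assoc, h2W]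
  have c41 : prob p (X₄ ∩ (A ∩ W)) = prob p (X₁ ∩ (A ∩ W)) := by
    rw [← c21, ← Set.inter_assoc, ← Set.inter_assoc, h4A]
  have c42 : prob p (X₄ ∩ (A ∩ Wᶜ)) = prob p (X₂ ∩ (A ∩ Wᶜ)) := by
    rw [← Set.inter_assoc, ← Set.inter_assoc, h4A]
  have c43 : prob p (X₄ ∩ (Aᶜ ∩ W)) = prob p (X₃ ∩ (Aᶜ ∩ W)) := by
    rw [← Set.inter_assoc, ← Set.inter_assoc, Set.inter_comm X₄ Aᶜ, Set.inter_comm X₃ Aᶜ,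
      Set.inter_assoc, Set.inter_assoc, h4W]
  have c34 : prob p (X₃ ∩ (Aᶜ ∩ Wᶜ ∩ Γ)) = prob p (X₂ ∩ (Aᶜ ∩ Wᶜ ∩ Γ)) := by
    congr 1
    ext ω
    have h := Set.ext_iff.1 h2Γ ω
    simp only [Set.mem_inter_iff, Set.mem_compl_iff] at h ⊢
    tauto
  have c44 : prob p (X₄ ∩ (Aᶜ ∩ Wᶜ ∩ Γ)) = prob p (X₂ ∩ (Aᶜ ∩ Wᶜ ∩ Γ)) := by
    congr 1
    ext ω
    have h := Set.ext_iff.1 h4Γ ω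
    simp only [Set.mem_inter_iff, Set.mem_compl_iff] at h ⊢
    tauto
  -- type probabilities
  have hsum := prob_eq_sum_five p A W Γ Set.univ
  simp only [Set.univ_inter, prob_univ] at hsum
  have PAW := prob_inter_union_AW p (A := A) (W := W) Set.univ
  have PA := prob_inter_A p (A := A) (W := W) Set.univ
  have PAc := prob_inter_Ac p (A := A) (W := W) (Γ := Γ) Set.univ
  have PAcWc := prob_inter_AcWc p (A := A) (W := W) (Γ := Γ) Set.univ
  have PAΓ := prob_inter_union_AΓ p hWΓ Set.univ
  simp only [Set.univ_inter] at PAW PA PAc PAcWc PAΓ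
  -- masses of the cluster events
  have MX0 := prob_eq_sum_five p A W Γ X₀
  have MX1 := prob_eq_sum_five p A W Γ X₁
  have MX2 := prob_eq_sum_five p A W Γ X₂
  have MX3 := prob_eq_sum_five p A W Γ X₃
  have MX4 := prob_eq_sum_five p A W Γ X₄
  rw [c21, c23] at MX2
  rw [c31, c32, c34] at MX3
  rw [c41, c42, c43, c44] at MX4
  have MX0A := prob_inter_A p (A := A) (W := W) X₀
  have MX1A := prob_inter_A p (A := A) (W := W) X₁
  have MX2A := prob_inter_A p (A := A) (W := W) X₂
  have MX3A := prob_inter_A p (A := A) (W := W) X₃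
  have MX4A := prob_inter_A p (A := A) (W := W) X₄
  rw [c21] at MX2A
  rw [c31, c32] at MX3A
  rw [c41, c42] at MX4A
  have MX1AΓ := prob_inter_union_AΓ p hWΓ X₁
  have MX1AcWc := prob_inter_AcWc p (A := A) (W := W) (Γ := Γ) X₁
  have Mmix := prob_mix p (A := A) (W := W) (Γ := Γ) X₀ X₁
  have MmixA := prob_mixA p (A := A) (W := W) (Γ := Γ) X₀ X₁
  have Mmix3 := prob_mix3 p (A := A) (W := W) (Γ := Γ) X₁ X₂ X₃
  have Mmix4 := prob_mix4 p (A := A) (W := W) (Γ := Γ) X₀ X₁ X₂ X₃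
  -- Harris slacks
  have hT1up : IsUpperSet (A ∩ W) := hAup.inter hWup
  have hAΓup : IsUpperSet (A ∪ Γ) := hAup.union hΓup
  have har : ∀ {X S : Set (Config E)}, IsUpperSet X → IsUpperSet S →
      0 ≤ prob p (X ∩ S) - prob p S * prob p X := fun hX hS => by
    rw [mul_comm]; exact sub_nonneg.2 (prob_mul_prob_le_prob_inter hp hX hS)
  have hHar0_1 := har hX₀up hT1up
  have hHar0_12 := har hX₀up hAup
  have hAWup : IsUpperSet (A ∪ W) := hAup.union hWup
  have hHar0_123 := har hX₀up hAWup
  have MX0AW := prob_inter_union_AW p (A := A) (W := W) X₀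
  have hHar1_1 := har hX₁up hT1up
  have hHar1_12 := har hX₁up hAup
  have hHar1_124 := har hX₁up hAΓup
  have hHar2_1 := har hX₂up hT1up
  have hHar2_12 := har hX₂up hAup
  have hHar3_1 := har hX₃up hT1up
  have hHar3_12 := har hX₃up hAup
  have hHar4_1 := har hX₄up hT1up
  have hHar4_12 := har hX₄up hAup
  rw [MX0] at hHar0_1 hHar0_12 hHar0_123
  rw [MX0A, PA] at hHar0_12
  rw [MX0AW, PAW] at hHar0_123
  rw [MX1] at hHar1_1 hHar1_12 hHar1_124
  rw [MX1A, PA] at hHar1_12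
  rw [MX1AΓ, PAΓ] at hHar1_124
  rw [MX2, c21] at hHar2_1
  rw [MX2, MX2A, PA] at hHar2_12
  rw [MX3, c31] at hHar3_1
  rw [MX3, MX3A, PA] at hHar3_12
  rw [MX4, c41] at hHar4_1
  rw [MX4, MX4A, PA] at hHar4_12
  -- the BHK-avoidance slack
  have hNA1'raw := sub_nonneg.2 hNA₁'
  rw [MX1AcWc, PAcWc] at hNA1'raw
  have hNA1' : 0 ≤ (prob p (X₁ ∩ (Aᶜ ∩ Wᶜ ∩ Γ)) + prob p (X₁ ∩ (Aᶜ ∩ Wᶜ ∩ Γᶜ))) * prob p (Aᶜ ∩ Wᶜ ∩ Γ)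
      - prob p (X₁ ∩ (Aᶜ ∩ Wᶜ ∩ Γ)) * (prob p (Aᶜ ∩ Wᶜ ∩ Γ) + prob p (Aᶜ ∩ Wᶜ ∩ Γᶜ)) := by
    linear_combination hNA1'raw
  -- monotonicity slacks
  have mono : ∀ {X Y : Set (Config E)} (T : Set (Config E)), X ⊆ Y →
      0 ≤ prob p (Y ∩ T) - prob p (X ∩ T) :=
    fun T h => sub_nonneg.2 (prob_mono hp (Set.inter_subset_inter_left _ h))
  have h02 : X₀ ⊆ X₂ := h01.trans h12
  have h03 : X₀ ⊆ X₃ := h01.trans h13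
  have h04 : X₀ ⊆ X₄ := h02.trans h24
  have hm11_m10 := mono (A ∩ W) h01
  have hm21_m20 := mono (A ∩ Wᶜ) h01
  have hm22_m20 := mono (A ∩ Wᶜ) h02
  have hm22_m21 := mono (A ∩ Wᶜ) h12
  have hm31_m30 := mono (Aᶜ ∩ W) h01
  have hm33_m30 := mono (Aᶜ ∩ W) h03
  have hm33_m31 := mono (Aᶜ ∩ W) h13
  have hm41_m40 := mono (Aᶜ ∩ Wᶜ ∩ Γ) h01
  have hm42_m40 := mono (Aᶜ ∩ Wᶜ ∩ Γ) h02
  have hm51_m50 := mono (Aᶜ ∩ Wᶜ ∩ Γᶜ) h01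
  have hm52_m50 := mono (Aᶜ ∩ Wᶜ ∩ Γᶜ) h02
  have hm53_m50 := mono (Aᶜ ∩ Wᶜ ∩ Γᶜ) h03
  have hm54_m50 := mono (Aᶜ ∩ Wᶜ ∩ Γᶜ) h04
  -- (P1) and the inductive atom in the type vocabulary
  have hP1b' := sub_nonneg.2 hP1b
  have hP1c' := sub_nonneg.2 hP1c
  rw [MX1] at hZC₁
  -- the weights
  have hp0 := hp.nonneg f₁
  have hp1 : 0 ≤ 1 - p f₁ := sub_nonneg.2 (hp.le_one f₁)
  have hq0 := hp.nonneg f₂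
  have hq1 : 0 ≤ 1 - p f₂ := sub_nonneg.2 (hp.le_one f₂)
  have hT1 : 0 ≤ prob p (A ∩ W) := prob_nonneg hp _
  have hT2 : 0 ≤ prob p (A ∩ Wᶜ) := prob_nonneg hp _
  have hT3 : 0 ≤ prob p (Aᶜ ∩ W) := prob_nonneg hp _
  have hT4 : 0 ≤ prob p (Aᶜ ∩ Wᶜ ∩ Γ) := prob_nonneg hp _
  have hT5 : 0 ≤ prob p (Aᶜ ∩ Wᶜ ∩ Γᶜ) := prob_nonneg hp _
  -- rewrite the goal into the masses
  rw [PeL, PUeL, PenL, PUenL, PU, PB, PD, PAW, PA, PAc, PAcWc, MX1A, Mmix3, Mmix4, MmixA,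
    Mmix, MX0]
  -- the certificate
  have key := zc_a3ow_cert (p f₁) (p f₂) (prob p (A ∩ W)) (prob p (A ∩ Wᶜ)) (prob p (Aᶜ ∩ W))
    (prob p (Aᶜ ∩ Wᶜ ∩ Γ)) (prob p (Aᶜ ∩ Wᶜ ∩ Γᶜ))
    (prob p (X₀ ∩ (A ∩ W))) (prob p (X₁ ∩ (A ∩ W))) (prob p (X₀ ∩ (A ∩ Wᶜ))) (prob p (X₁ ∩ (A ∩ Wᶜ)))
    (prob p (X₂ ∩ (A ∩ Wᶜ))) (prob p (X₀ ∩ (Aᶜ ∩ W))) (prob p (X₁ ∩ (Aᶜ ∩ W))) (prob p (X₃ ∩ (Aᶜ ∩ W)))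
    (prob p (X₀ ∩ (Aᶜ ∩ Wᶜ ∩ Γ))) (prob p (X₁ ∩ (Aᶜ ∩ Wᶜ ∩ Γ))) (prob p (X₂ ∩ (Aᶜ ∩ Wᶜ ∩ Γ)))
    (prob p (X₀ ∩ (Aᶜ ∩ Wᶜ ∩ Γᶜ))) (prob p (X₁ ∩ (Aᶜ ∩ Wᶜ ∩ Γᶜ))) (prob p (X₂ ∩ (Aᶜ ∩ Wᶜ ∩ Γᶜ)))
    (prob p (X₃ ∩ (Aᶜ ∩ Wᶜ ∩ Γᶜ))) (prob p (X₄ ∩ (Aᶜ ∩ Wᶜ ∩ Γᶜ)))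
    hp0 hp1 hq0 hq1 hT1 hT2 hT3 hT4 hT5 hsum.symm hHar0_1 hHar0_12 hHar0_123 hHar1_1 hHar1_12
    hHar1_124 hHar2_1 hHar2_12 hHar3_1 hHar3_12 hHar4_1 hHar4_12 hNA1' hP1b' hP1c' hZC₁ hm11_m10
    hm21_m20 hm22_m20 hm22_m21 hm31_m30 hm33_m30 hm33_m31 hm41_m40 hm42_m40 hm51_m50 hm52_m50
    hm53_m50 hm54_m50
  refine le_of_le_of_eq key ?_
  ring

end TheoremJAbstract

end Summit.Ventures.PercRepro2
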